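import Mathlib
import Literature.Computability.Complexity.RangeAvoidance
import Summits.PneNP.PneNP.Theorems.PstarSALevel
import Summits.PneNP.PneNP.Theorems.PstarGapLemma
import Summits.PneNP.PneNP.Theorems.PstarProductRank

/-!
# Greedy induced matchings and the one-dense-parity case of the gap lemma (ROUND-24 item T24.8c′)

FRONTIER range-avoidance ladder, rung F-N3, ROUND 24 (cell `pnp-ideate`; free-standing combinatorics for the rank route of the gap
lemma `PstarGapLemma.PstarGapLemmaSO` — nothing here bears on `P` versus `NP`).  Sequel of `PstarProductRank`.

* `exists_inducedMatching` (greedy): a loopless multigraph `j ↦ {p j, q j}` (`j ∈ J`) without parallel edges in which every vertex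
  lies on at most `Δ` edges has an INDUCED MATCHING `M` (`PstarProductRank.IsInducedMatching`) with `|J| ≤ 2Δ²·|M|` — pick an edge
  `{p₀, q₀}`, delete the at most `|N(p₀) ∪ N(q₀)|·Δ ≤ 2Δ²` edges with an endpoint in `N(p₀) ∪ N(q₀)` (this contains `p₀, q₀`),
  recurse on the rest; an edge of `J` with both endpoints covered is either the picked edge (no parallel edges), or joins the
  picked edge to a later one (impossible: its far endpoint would lie in `N(p₀) ∪ N(q₀)`), or lies inside the later cover
  (induction).
* `card_le_of_const` = greedy ∘ `IsInducedMatching.finrank_add_card_le`: if the product sum `Σ_{j∈J} a_{p j} a_{q j}` is constant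
  on an affine subspace `v₀ + V` of `ι → K` then **`|J| ≤ 2Δ² · (|ι| − finrank V)`**.
* `card_le_of_andPairs_const`: the same for the AND-pair graph `j ↦ {vars j 2, vars j 3}` of a `4`-local instance with injective
  positions, simple overlaps (`PstarSALevel.SimpleOverlap`: no parallel AND pairs) and maximum variable degree `Δ`
  (`PstarGapLemma.MaxDegree`): `|J| ≤ 2Δ² · (n − finrank V)` — the rank half of the gap lemma in the one-dense-parity case
  (`K(Δ) ≤ 2Δ²` there, against the necessary `K(Δ) ≥ Δ²/2` of the `K_{Δ,Δ}` cluster).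
-/

set_option linter.dupNamespace false -- `Summit.PneNP.PneNP.…`: summit = sub-problem name (D-0017 single-conjunct layout)

open Finset Module
open Summit.PneNP.PneNP.Theorems.PstarProductRank

namespace Summit.PneNP.PneNP.Theorems.PstarInducedMatching

variable {K : Type*} [Field K] {ι κ : Type*} [DecidableEq ι]

/-! ## Edges at a vertex, neighbours -/

/-- The edges of `J` at the vertex `v`. -/
def edgesAt (J : Finset κ) (p q : κ → ι) (v : ι) : Finset κ := J.filter fun j => p j = v ∨ q j = v

/-- The neighbours of `v`: the other endpoints of the `J`-edges at `v`. -/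
def nbrs (J : Finset κ) (p q : κ → ι) (v : ι) : Finset ι :=
  ((J.filter fun j => p j = v).image q) ∪ ((J.filter fun j => q j = v).image p)

variable {J : Finset κ} {p q : κ → ι}

/-- The `q`-end of an edge is a neighbour of its `p`-end. -/
theorem mem_nbrs_of_p_eq {j : κ} {v : ι} (hj : j ∈ J) (h : p j = v) : q j ∈ nbrs J p q v :=
  mem_union_left _ (mem_image.2 ⟨j, mem_filter.2 ⟨hj, h⟩, rfl⟩)

/-- The `p`-end of an edge is a neighbour of its `q`-end. -/
theorem mem_nbrs_of_q_eq {j : κ} {v : ι} (hj : j ∈ J) (h : q j = v) : p j ∈ nbrs J p q v :=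
  mem_union_right _ (mem_image.2 ⟨j, mem_filter.2 ⟨hj, h⟩, rfl⟩)

/-- Without loops, a vertex has at most as many neighbours as edges. -/
theorem card_nbrs_le (hloop : ∀ j ∈ J, p j ≠ q j) (v : ι) : (nbrs J p q v).card ≤ (edgesAt J p q v).card := by
  classical
  unfold nbrs edgesAt
  have hdis : Disjoint (J.filter fun j => p j = v) (J.filter fun j => q j = v) :=
    disjoint_filter.2 fun j hj hp hq => hloop j hj (hp.trans hq.symm)
  calc _ ≤ ((J.filter fun j => p j = v).image q).card + ((J.filter fun j => q j = v).image p).card := card_union_le _ _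
    _ ≤ (J.filter fun j => p j = v).card + (J.filter fun j => q j = v).card := add_le_add card_image_le card_image_le
    _ = ((J.filter fun j => p j = v) ∪ (J.filter fun j => q j = v)).card := (card_union_of_disjoint hdis).symm
    _ = _ := by rw [filter_or]

/-! ## The greedy induced matching -/

/-- **Greedy induced matching.**  A loopless multigraph without parallel edges (in either orientation) in which every vertex lies
on at most `Δ` edges has an induced matching `M` with `|J| ≤ 2Δ² · |M|`: pick an edge `{p₀, q₀}`, delete the `≤ 2Δ²` edges with
an endpoint in `N(p₀) ∪ N(q₀)`, and recurse on the rest. -/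
theorem exists_inducedMatching (p q : κ → ι) (Δ : ℕ) :
    ∀ J : Finset κ, (∀ j ∈ J, p j ≠ q j) →
      (∀ j ∈ J, ∀ j' ∈ J, p j = p j' → q j = q j' → j = j') →
      (∀ j ∈ J, ∀ j' ∈ J, p j = q j' → q j = p j' → j = j') →
      (∀ v, (edgesAt J p q v).card ≤ Δ) →
      ∃ M : Finset κ, IsInducedMatching J M p q ∧ J.card ≤ 2 * Δ ^ 2 * M.card := by
  classical
  intro J
  induction J using Finset.strongInduction with
  | H J ih =>
  intro hloop hpar hpar' hdeg
  rcases J.eq_empty_or_nonempty with rfl | ⟨j₀, hj₀⟩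
  · exact ⟨∅, ⟨Subset.rfl, by simp, by simp, by simp⟩, by simp⟩
  -- the deleted neighbourhood and the remaining edges
  set N : Finset ι := nbrs J p q (p j₀) ∪ nbrs J p q (q j₀) with hN
  set J' : Finset κ := J.filter fun j => ¬ (p j ∈ N ∨ q j ∈ N) with hJ'
  have hpN : p j₀ ∈ N := mem_union_right _ (mem_nbrs_of_q_eq hj₀ rfl)
  have hqN : q j₀ ∈ N := mem_union_left _ (mem_nbrs_of_p_eq hj₀ rfl)
  have hj₀J' : j₀ ∉ J' := by simp [hJ', hpN]
  have hJ'sub : J' ⊆ J := filter_subset _ _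
  have hss : J' ⊂ J := Finset.ssubset_iff_subset_ne.2 ⟨hJ'sub, fun h => hj₀J' (h ▸ hj₀)⟩
  -- recurse
  obtain ⟨M', hM', hcard'⟩ := ih J' hss (fun j hj => hloop j (hJ'sub hj))
    (fun j hj j' hj' => hpar j (hJ'sub hj) j' (hJ'sub hj')) (fun j hj j' hj' => hpar' j (hJ'sub hj) j' (hJ'sub hj'))
    (fun v => (card_le_card (filter_subset_filter _ hJ'sub)).trans (hdeg v))
  -- at most `2Δ²` edges are deleted
  have hD : (J.filter fun j => p j ∈ N ∨ q j ∈ N).card ≤ 2 * Δ ^ 2 := by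
    have hNcard : N.card ≤ 2 * Δ := by
      have e1 := (card_nbrs_le hloop (p j₀)).trans (hdeg (p j₀))
      have e2 := (card_nbrs_le hloop (q j₀)).trans (hdeg (q j₀))
      have e3 : N.card ≤ (nbrs J p q (p j₀)).card + (nbrs J p q (q j₀)).card := by
        rw [hN]; exact card_union_le _ _
      omega
    have hsub : (J.filter fun j => p j ∈ N ∨ q j ∈ N) ⊆ N.biUnion (edgesAt J p q) := by
      intro j hj
      rw [mem_filter] at hj
      rw [mem_biUnion]
      rcases hj.2 with h | h
      · exact ⟨p j, h, mem_filter.2 ⟨hj.1, Or.inl rfl⟩⟩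
      · exact ⟨q j, h, mem_filter.2 ⟨hj.1, Or.inr rfl⟩⟩
    calc _ ≤ (N.biUnion (edgesAt J p q)).card := card_le_card hsub
      _ ≤ N.card * Δ := card_biUnion_le_card_mul _ _ _ fun v _ => hdeg v
      _ ≤ 2 * Δ * Δ := Nat.mul_le_mul_right _ hNcard
      _ = 2 * Δ ^ 2 := by ring
  have hsplit : J'.card + (J.filter fun j => p j ∈ N ∨ q j ∈ N).card = J.card := by
    rw [hJ', add_comm]
    exact card_filter_add_card_filter_not _
  -- the recursive matching avoids `N`; edges at `{p₀, q₀}` end in `N`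
  have hcovN : ∀ x ∈ cover M' p q, x ∉ N := by
    intro x hx
    obtain ⟨j, hj, hxj⟩ := mem_cover.1 hx
    have hjJ' := hM'.subset hj
    rw [hJ', mem_filter, not_or] at hjJ'
    rcases hxj with rfl | rfl
    exacts [hjJ'.2.1, hjJ'.2.2]
  have hnb_p : ∀ j' ∈ J, (p j' = p j₀ ∨ p j' = q j₀) → q j' ∈ N := by
    rintro j' hj' (h | h)
    · exact mem_union_left _ (mem_nbrs_of_p_eq hj' h)
    · exact mem_union_right _ (mem_nbrs_of_p_eq hj' h)
  have hnb_q : ∀ j' ∈ J, (q j' = p j₀ ∨ q j' = q j₀) → p j' ∈ N := by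
    rintro j' hj' (h | h)
    · exact mem_union_left _ (mem_nbrs_of_q_eq hj' h)
    · exact mem_union_right _ (mem_nbrs_of_q_eq hj' h)
  have hcov_ins : ∀ x, x ∈ cover (insert j₀ M') p q → (x = p j₀ ∨ x = q j₀) ∨ x ∈ cover M' p q := by
    intro x hx
    obtain ⟨j, hj, hxj⟩ := mem_cover.1 hx
    rcases mem_insert.1 hj with rfl | hj
    · exact Or.inl hxj
    · exact Or.inr (mem_cover.2 ⟨j, hj, hxj⟩)
  refine ⟨insert j₀ M', ⟨?_, ?_, ?_, ?_⟩, ?_⟩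
  · exact insert_subset hj₀ (hM'.subset.trans hJ'sub)
  · intro j hj
    rcases mem_insert.1 hj with rfl | hj
    exacts [hloop _ hj₀, hloop _ (hJ'sub (hM'.subset hj))]
  · intro j hj j' hj' hne
    rcases mem_insert.1 hj with rfl | hjM <;> rcases mem_insert.1 hj' with rfl | hj'M
    · exact absurd rfl hne
    · have hp' := hcovN _ (mem_cover.2 ⟨j', hj'M, Or.inl rfl⟩)
      have hq' := hcovN _ (mem_cover.2 ⟨j', hj'M, Or.inr rfl⟩)
      exact ⟨fun h => hp' (h ▸ hpN), fun h => hq' (h ▸ hpN), fun h => hp' (h ▸ hqN), fun h => hq' (h ▸ hqN)⟩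
    · have hp' := hcovN _ (mem_cover.2 ⟨j, hjM, Or.inl rfl⟩)
      have hq' := hcovN _ (mem_cover.2 ⟨j, hjM, Or.inr rfl⟩)
      exact ⟨fun h => hp' (h ▸ hpN), fun h => hp' (h ▸ hqN), fun h => hq' (h ▸ hpN), fun h => hq' (h ▸ hqN)⟩
    · exact hM'.disjoint j hjM j' hj'M hne
  · intro j' hj'J hp hq
    rcases hcov_ins _ hp with hp0 | hpM <;> rcases hcov_ins _ hq with hq0 | hqM
    · have hl := hloop j' hj'J
      rcases hp0 with hp0 | hp0 <;> rcases hq0 with hq0 | hq0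
      · exact absurd (hp0.trans hq0.symm) hl
      · exact mem_insert.2 (Or.inl (hpar j' hj'J j₀ hj₀ hp0 hq0))
      · exact mem_insert.2 (Or.inl (hpar' j' hj'J j₀ hj₀ hp0 hq0))
      · exact absurd (hp0.trans hq0.symm) hl
    · exact absurd (hnb_p j' hj'J hp0) (hcovN _ hqM)
    · exact absurd (hnb_q j' hj'J hq0) (hcovN _ hpM)
    · by_cases hj'J' : j' ∈ J'
      · exact mem_insert_of_mem (hM'.induced j' hj'J' hpM hqM)
      · exfalso
        rw [hJ', mem_filter, not_and, not_not] at hj'J'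
        rcases hj'J' hj'J with h | h
        exacts [hcovN _ hpM h, hcovN _ hqM h]
  · rw [card_insert_of_notMem fun h => hj₀J' (hM'.subset h)]
    have e : 2 * Δ ^ 2 * (M'.card + 1) = 2 * Δ ^ 2 * M'.card + 2 * Δ ^ 2 := by ring
    rw [e]
    omega

/-- **The one-dense-parity case of the gap lemma (rank route).**  If the product sum of a loopless multigraph without parallel
edges and with vertex degrees `≤ Δ` is constant on an affine subspace `v₀ + V`, then `|J| ≤ 2Δ² · codim V`. -/
theorem card_le_of_const [Fintype ι] (Δ : ℕ) (hloop : ∀ j ∈ J, p j ≠ q j)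
    (hpar : ∀ j ∈ J, ∀ j' ∈ J, p j = p j' → q j = q j' → j = j')
    (hpar' : ∀ j ∈ J, ∀ j' ∈ J, p j = q j' → q j = p j' → j = j')
    (hdeg : ∀ v, (edgesAt J p q v).card ≤ Δ)
    {V : Submodule K (ι → K)} {v₀ : ι → K} (h : ∀ v ∈ V, qform J p q (v₀ + v) = qform J p q v₀) :
    J.card ≤ 2 * Δ ^ 2 * (Fintype.card ι - finrank K V) := by
  obtain ⟨M, hM, hJ⟩ := exists_inducedMatching p q Δ J hloop hpar hpar' hdeg
  have h2 := hM.finrank_add_card_le (K := K) h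
  calc J.card ≤ 2 * Δ ^ 2 * M.card := hJ
    _ ≤ 2 * Δ ^ 2 * (Fintype.card ι - finrank K V) := Nat.mul_le_mul_left _ (by omega)

end Summit.PneNP.PneNP.Theorems.PstarInducedMatching

namespace Summit.PneNP.PneNP.Theorems.PstarInducedMatching

open Finset Module Literature.Computability.Complexity
open Summit.PneNP.PneNP.Theorems.PstarProductRank
open Summit.PneNP.PneNP.Theorems.PstarSALevel (varSet SimpleOverlap)
open Summit.PneNP.PneNP.Theorems.PstarGapLemma (MaxDegree)

/-! ## The AND-pair graph of a `4`-local instance -/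

/-- Two distinct common elements give an intersection of size `≥ 2`. -/
private theorem two_le_card_inter {α : Type*} [DecidableEq α] {s t : Finset α} {a b : α} (hab : a ≠ b)
    (has : a ∈ s) (hbs : b ∈ s) (hat : a ∈ t) (hbt : b ∈ t) : 2 ≤ (s ∩ t).card := by
  rw [← card_pair hab]
  exact card_le_card (insert_subset (mem_inter.2 ⟨has, hat⟩) (singleton_subset_iff.2 (mem_inter.2 ⟨hbs, hbt⟩)))

/-- **Rank half of the gap lemma, one dense parity.**  For a `4`-local instance with injective positions, simple overlaps and
maximum variable degree `Δ`, and a set `J` of outputs: if the AND-product sum `Σ_{j∈J} a_{vars j 2} · a_{vars j 3}` is constant on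
an affine subspace `v₀ + V` of `Fin n → K`, then `|J| ≤ 2Δ² · (n − finrank V)`. -/
theorem card_le_of_andPairs_const {K : Type*} [Field K] {n m : ℕ} (I : LocalMap 4 n m)
    (hinj : ∀ j, Function.Injective (I.vars j)) (hS : SimpleOverlap I) {Δ : ℕ} (hΔ : MaxDegree Δ I) (J : Finset (Fin m))
    {V : Submodule K (Fin n → K)} {v₀ : Fin n → K}
    (h : ∀ v ∈ V, qform J (fun j => I.vars j 2) (fun j => I.vars j 3) (v₀ + v) =
      qform J (fun j => I.vars j 2) (fun j => I.vars j 3) v₀) :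
    J.card ≤ 2 * Δ ^ 2 * (n - finrank K V) := by
  have h23 : ∀ j, I.vars j 2 ≠ I.vars j 3 := fun j e => absurd (hinj j e) (by decide)
  have hmem : ∀ j (s : Fin 4), I.vars j s ∈ varSet I j := fun j s => by
    unfold varSet; exact mem_image_of_mem _ (mem_univ s)
  have key := card_le_of_const (K := K) (J := J) (p := fun j => I.vars j 2) (q := fun j => I.vars j 3) Δ
    (fun j _ => h23 j) ?_ ?_ ?_ h
  · simpa using key
  · intro j _ j' _ hp hq
    by_contra hne
    have h2 := two_le_card_inter (h23 j) (hmem j 2) (hmem j 3) (hp ▸ hmem j' 2) (hq ▸ hmem j' 3)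
    have h1 := hS j j' hne
    omega
  · intro j _ j' _ hp hq
    by_contra hne
    have h2 := two_le_card_inter (h23 j) (hmem j 2) (hmem j 3) (hp ▸ hmem j' 3) (hq ▸ hmem j' 2)
    have h1 := hS j j' hne
    omega
  · intro v
    refine (card_le_card fun j hj => ?_).trans (hΔ v)
    unfold edgesAt at hj
    rw [mem_filter] at hj ⊢
    refine ⟨mem_univ j, ?_⟩
    rcases hj.2 with e | e
    · exact e ▸ hmem j 2
    · exact e ▸ hmem j 3

end Summit.PneNP.PneNP.Theorems.PstarInducedMatching
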